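/- Copyright: the b2b-balaban cell (near-miss cell 7), T⁴-continuum fan-out; row NE7b CRUX team (2), seat
t4-ne7b-formalise-leaf-06 (gen 31) (the S12h ∕ S12i-opt «NON-VACUITY TOY» pattern of leaf-09's
`HistoryRealiseCellsRunApexWitness{,Data,T3b}` carried to the END-v3′ W-family apex structures of the OWNER's M5-2 and of
INTERFACE REQUEST IR-44-1: `CountRoadWitnessT3bWT` ∕ `…WTV` ∕ `…WTVS`).  Released under the licence of the surrounding project. -/
import Summits.QuantumFields.BalabanUV.T4Continuum.Support.HistoryRealiseCellsRunHeadlineT3bWTVS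
import Summits.QuantumFields.BalabanUV.T4Continuum.Support.HistoryRealiseCellsRunApexWitnessT3b

/-!
# Realised histories at the apex over END v3′, W-family: `CountRoadWitnessT3bWT ≃ …WTV`, and the `…WTV` ∕ `…WTVS` shapes are NON-VACUOUS

Summits-side support leaf of the T⁴-continuum cell (rung (B)+1 on a FINITE torus only; NOT infinite volume, NOT the
mass gap, NOT the Clay statement; NOT a proof of the spine estimate NE7b — the cell's OWN estimate, NOT PRINTED, NOT
PROVED).  Row NE7b, route «COUNT» ∕ R-P1, re-open object (α); the S12h pattern (owner ruling R-OWNER-23-9 (C) «non-vacuity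
toy optional») applied to the witness structures of rows S20 ∕ IR-44-1.  [folklore] compositions BY NAME over landed modules
+ leaf-09's [decided toy]; no `[cite:]` tag; no `def … : Prop`; nothing printed is asserted; zero `sorry`.

WHY.  The V-headline `HistoryRealiseCellsRunApexT3bWTV.continuumYM4Torus_of_countRoadT3bWTV_fsc` (p263890) and the
weighted headline `HistoryRealiseCellsRunHeadlineT3bWTVS.continuumYM4Torus_of_countRoadT3bWTVS_fsc` (p266167) carry the
per-datum binder `hData : ForSmallCouplings D (fun g₀ => ∀ os, ∃ ι α π …, Nonempty (CountRoadWitnessT3bWTV(S) D C O (θᵥ) …))`.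
The referee's pass-53 reading (OI-65) records «`hData` not inhabited».  Two kernel facts settle what CAN be settled
without reading Bałaban: (i) the `κ := costT` witness shape is not merely WEAKER than the total-form shape `…WT` (the
owner's `toWT`) but EQUIVALENT to it — a total-form witness prices its members at a realised cost whose booked life cost
is below the model's, and the print-priced shape `pshapeTH` is MONOTONE in that life cost, so its price sentence implies
the one at `costT` (`CountRoadWitnessT3bWT.toWTV`); (ii) hence leaf-09's decided toy of `CountRoadWitnessT3b` (p-landed
`toyWitnessT3bOf`: no live component, constant run, trivial product observable) transports along
`toWT ≫ toWTV ≫ ofWTV` to BOTH new shapes: `hData` of the V-headline and of the weighted headline is a SATISFIABLE SHAPE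
(on `toyData F G` over a subsingleton gauge group ∕ at `SU(1)`, for every `C O rr d n` and every `θᵥ ≥ 0`).

WHAT.
* §1 `pshapeTH_le_of_lifeCost` — `pshapeTH` is monotone in the realised cost through its booked life cost (`Δ, Λ′ ≥ 0`).
* §2 **`CountRoadWitnessT3bWT.toWTV`** (every field copied; `priceM`∕`priceM′` pushed to `costT` by §1 with `cost_le`∕`cost_le′`),
  `toWTV_data`, and the equivalence **`nonempty_countRoadWitnessT3bWTV_iff`** (`toWTV` here, the owner's `toWT` back).
* §3 **`toyWitnessT3bWTVOf`**, **`toyWitnessT3bWTVSOf`** (leaf-09's `toyWitnessT3bOf` transported), `nonempty_…_toy`,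
  **`forSmallCouplings_countRoadWitnessT3bWTV_toy{,SU1}`**, **`forSmallCouplings_countRoadWitnessT3bWTVS_toy{,SU1}`** — the two
  headlines' `hData` binders VERBATIM on one datum.
* §4 `isEmpty_countRoadWitnessT3bWTVS_stubData` — on the tree's placeholder inhabitant (χ := 0) the shape is EMPTY by the
  (γ) floor field alone (as for S12h ∕ S12i-opt): «satisfiable» on the χ := 1 twin only.

HONEST (typer DV-13 wording).  A node test of a hypothesis SHAPE on a decided toy where (B) FAILS
(`not_endStatementBPrinted_toy`): NO instance of `HybridNE7Under` ∕ `ContinuumYM4Torus` is or could be derived from it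
through the headlines (their binder `hB`).  With no live component every H3-side field — pedigrees, `realised`, the
price sentences `priceM`∕`priceM′` at `costT`, the weight display `huV`, `resumM` — is VACUOUS BY DESIGN; OI-65's
located reading (the CREDIT part — now displayed as `HistoryBankingCreditRead.FactorRead` ∕
`HistoryBankingDiscountCharge.RoundingRoom` (row S21, R-OWNER-45-1) —, the event-product reading, `resumM`, `e^{−Ξ}`, the
`FcM·RfM ≤ ∏ pshapeTH·…` inequality are READ, not kernel) is UNCHANGED: inhabiting the shape on a toy is not inhabiting it
on Bałaban's data.  The constants-side
binders of the headlines (`θ hθ hslack hθJ`, signs, stride arithmetic) are not fields of the structures and are not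
touched.  Discharges NOTHING of the nine spine estimates; NE7b NOT proved; spine 0∕9.  HONEST DEPENDENCY (cell): continuum
YM on T⁴ ⇐ BetaPertH ∧ nine spine estimates (0/9 proved); BetaPertH ⇐ (D1) ∧ (D4) ∧ CAP+tail; G-an2-4 gates asym, D1 and
NE2/3/4.  This file changes none of it. -/

open Finset MeasureTheory
open Literature.MathematicalPhysics.QuantumFieldTheory.Balaban1983to89
open Literature.MathematicalPhysics.QuantumFieldTheory.Balaban1983to89.B13ScaleTransfer
open Literature.MathematicalPhysics.QuantumFieldTheory.Balaban1983to89.T4FiniteEpsInhabited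
open Missing AveragingRT T4Continuum T4StabilitySocket T4MatchingClosure T4IndicatorShell T4LiveClassFibration
open T4RenewalChains T4PersistenceDictionary T4BranchingRecordsGas T4ContinuumYM4Torus
open T4PersistentHistoryCount T4BankedInduction T4PrintedShapeBanking T4PartnerMultiplicity T4TaggedShapeBanking
open Summit.QuantumFields.BalabanUV.T4Continuum.LateMergers
open Summit.QuantumFields.BalabanUV.T4Continuum.HistoryConstants
open Summit.QuantumFields.BalabanUV.T4Continuum.HistoryGen
open Summit.QuantumFields.BalabanUV.T4Continuum.HistoryAssemblyTerms
open Summit.QuantumFields.BalabanUV.T4Continuum.HistoryAssemblyPedigree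
open Summit.QuantumFields.BalabanUV.T4Continuum.HistoryAssemblyMult
open Summit.QuantumFields.BalabanUV.T4Continuum.HistorySocketTH
open Summit.QuantumFields.BalabanUV.T4Continuum.HistoryAssemblyRealiseRun
open Summit.QuantumFields.BalabanUV.T4Continuum.HistoryRealiseCellsRun
open Summit.QuantumFields.BalabanUV.T4Continuum.HistoryRealiseCellsRunApexT3b
open Summit.QuantumFields.BalabanUV.T4Continuum.HistoryRealiseCellsRunApexT3bW
open Summit.QuantumFields.BalabanUV.T4Continuum.HistoryRealiseCellsRunApexT3bWT
open Summit.QuantumFields.BalabanUV.T4Continuum.HistoryRealiseCellsRunApexT3bWTV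
open Summit.QuantumFields.BalabanUV.T4Continuum.HistoryRealiseCellsRunApexT3bWTVS
open Summit.QuantumFields.BalabanUV.T4Continuum.HistoryRealiseCellsRunHeadlineT3bWTVS
open Summit.QuantumFields.BalabanUV.T4Continuum.HistoryRealiseCellsRunApexWitness
open Summit.QuantumFields.BalabanUV.T4Continuum.HistoryRealiseCellsRunApexWitnessData
open Summit.QuantumFields.BalabanUV.T4Continuum.HistoryRealiseCellsRunApexWitnessT3b
open Summit.QuantumFields.BalabanUV.T4Continuum.HistoryBankingVolumePlug

namespace Summit.QuantumFields.BalabanUV.T4Continuum.HistoryRealiseCellsRunApexWitnessT3bWTVS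

noncomputable section

/-! ## §1 The print-priced shape is monotone in the realised cost -/

section Mono

variable {ε : Type*} [DecidableEq ε] (sh : ε → PEv) {O : PrintedO1s} {C : T4PrintedShapeBanking.Consts}

/-- **`pshapeTH` IS MONOTONE IN THE REALISED COST THROUGH ITS BOOKED LIFE COST** (`Δ, Λ′ ≥ 0`): the cost enters only as
`e^{+lifeCost (padW (dictWT sh R C.n₁) D) κ G}`. [folklore] -/
theorem pshapeTH_le_of_lifeCost {Δ Λ' : ℝ} (hΔ : 0 ≤ Δ) (hΛ : 0 ≤ Λ') (R : ℕ → ℕ) (g : ℕ → ℝ) (D : ℕ)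
    {κ κ' : Gen ε → ℕ → ℝ} {G : Gen ε}
    (h : lifeCost (padW (dictWT sh R C.n₁) D) κ G ≤ lifeCost (padW (dictWT sh R C.n₁) D) κ' G) :
    pshapeTH sh O C Δ Λ' R g D κ G ≤ pshapeTH sh O C Δ Λ' R g D κ' G := by
  unfold pshapeTH
  exact mul_le_mul_of_nonneg_left (mul_le_mul_of_nonneg_left
    (mul_le_mul_of_nonneg_left (Real.exp_le_exp.2 h) (Real.exp_pos _).le) (pow_nonneg hΛ _)) hΔ

end Mono

/-! ## §2 A total-form witness IS a `κ := costT` witness: the two shapes are equivalent -/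

section Equiv

variable {F : T4Family} {G : Type*} [GaugeGroup G] [MeasurableSpace G] [HaarData G]

/-- **A TOTAL-FORM WITNESS IS A `κ := costT` WITNESS**: every field copied, the realised costs `κ`∕`κ′` and their bounds
`cost_le`∕`cost_le′` DROPPED after pushing the price sentences `priceM`∕`priceM′` to the model's own booked cost by §1
(the other factors are nonnegative).  Converse of the owner's `CountRoadWitnessT3bWTV.toWT` (p263890). [folklore] -/
def CountRoadWitnessT3bWT.toWTV {D : FiniteEpsData F G} {C : T4PrintedShapeBanking.Consts} {O : PrintedO1s} {rr d n : ℕ}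
    {hn : 0 < n} {g₀ : ℕ → ℝ} {os : List (ULoop F)} {ι α π : Type} [DecidableEq ι] [DecidableEq α] [DecidableEq π]
    (X : CountRoadWitnessT3bWT D C O rr d n hn g₀ os ι α π) : CountRoadWitnessT3bWTV D C O rr d n hn g₀ os ι α π :=
  { l₀ := X.l₀, vol := X.vol, l₀_pos := X.l₀_pos, vol_pos := X.vol_pos, K₀ := X.K₀, T := X.T, A := X.A, A' := X.A',
    shA := X.shA, shB := X.shB, dead := X.dead, dead' := X.dead', nup := X.nup, mup := X.mup, Nup := X.Nup, Cc :=
    X.Cc, Rr := X.Rr, CcRec := X.CcRec, RrRec := X.RrRec, ν := X.ν, u := X.u, s₂ := X.s₂, q₀ := X.q₀, r := X.r, s :=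
    X.s, Wsh := X.Wsh, reprA := X.reprA, reprB := X.reprB, c₀ := X.c₀, n₁ := X.n₁, c₀_pos := X.c₀_pos, floor :=
    X.floor, floor' := X.floor', sites := X.sites, sites' := X.sites', Nup_nonneg := X.Nup_nonneg, nup_bd :=
    X.nup_bd, mup_bd := X.mup_bd, R := X.R, isRj := X.isRj, one_le_R := X.one_le_R, ped := X.ped, cellP := X.cellP,
    liveC := X.liveC, Zd := X.Zd, realised := X.realised, step_le := X.step_le, disjointJoins := X.disjointJoins,
    boxedBirths := X.boxedBirths,
    FcM := X.FcM, RfM := X.RfM, FcM' := X.FcM', RfM' := X.RfM',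
    priceM := fun K t ht hK τ hτ => (X.priceM K t ht hK τ hτ).trans
      (Finset.prod_le_prod (fun _ _ => mul_nonneg (pshapeTH_nonneg Prod.fst zero_le_one zero_le_one _ _ _ _ _)
        (Real.exp_pos _).le) fun q hq => mul_le_mul_of_nonneg_right
          (pshapeTH_le_of_lifeCost Prod.fst zero_le_one zero_le_one _ _ _ (X.cost_le K hK τ hτ q hq))
          (Real.exp_pos _).le),
    priceM' := fun K t ht hK τ hτ => (X.priceM' K t ht hK τ hτ).trans
      (Finset.prod_le_prod (fun _ _ => mul_nonneg (pshapeTH_nonneg Prod.fst zero_le_one zero_le_one _ _ _ _ _)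
        (Real.exp_pos _).le) fun q hq => mul_le_mul_of_nonneg_right
          (pshapeTH_le_of_lifeCost Prod.fst zero_le_one zero_le_one _ _ _ (X.cost_le' K hK τ hτ q hq))
          (Real.exp_pos _).le),
    upM := X.upM, deadM_nonneg := X.deadM_nonneg, resumM := X.resumM, FM_nonneg := X.FM_nonneg, upM' := X.upM',
    deadM'_nonneg := X.deadM'_nonneg, resumM' := X.resumM', FM'_nonneg := X.FM'_nonneg, shell := X.shell,
    budget := X.budget, sum_r := X.sum_r, sum_u := X.sum_u, sum_s := X.sum_s, sum_s₂ := X.sum_s₂ }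

/-- the conversion keeps the data the END reads (terms, weights, sizes, pedigrees, price factors) [folklore] -/
theorem CountRoadWitnessT3bWT.toWTV_data {D : FiniteEpsData F G} {C : T4PrintedShapeBanking.Consts} {O : PrintedO1s}
    {rr d n : ℕ} {hn : 0 < n} {g₀ : ℕ → ℝ} {os : List (ULoop F)} {ι α π : Type} [DecidableEq ι] [DecidableEq α]
    [DecidableEq π] (X : CountRoadWitnessT3bWT D C O rr d n hn g₀ os ι α π) :
    (CountRoadWitnessT3bWT.toWTV X).T = X.T ∧ (CountRoadWitnessT3bWT.toWTV X).A = X.A ∧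
      (CountRoadWitnessT3bWT.toWTV X).A' = X.A' ∧ (CountRoadWitnessT3bWT.toWTV X).R = X.R ∧
      (CountRoadWitnessT3bWT.toWTV X).ped = X.ped ∧ (CountRoadWitnessT3bWT.toWTV X).FcM = X.FcM ∧
      (CountRoadWitnessT3bWT.toWTV X).RfM = X.RfM :=
  ⟨rfl, rfl, rfl, rfl, rfl, rfl, rfl⟩

/-- **THE TOTAL-FORM AND THE `κ := costT` WITNESS SHAPES ARE EQUIVALENT** (inhabited together): `toWTV` here, the
owner's `toWT` back.  Located consequence: M5-2's removal of the H3 cost binders `κ κ′ cost_le cost_le′` from the witness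
loses NO strength and gains none at the level of the hypothesis shape; what M5-2 adds is the kernel VOLUME plug behind
`priceM` at `costT` (rows S19∕S20), not a weaker witness. [folklore] -/
theorem nonempty_countRoadWitnessT3bWTV_iff {D : FiniteEpsData F G} {C : T4PrintedShapeBanking.Consts} {O : PrintedO1s}
    {rr d n : ℕ} {hn : 0 < n} {g₀ : ℕ → ℝ} {os : List (ULoop F)} {ι α π : Type} [DecidableEq ι] [DecidableEq α]
    [DecidableEq π] :
    Nonempty (CountRoadWitnessT3bWTV D C O rr d n hn g₀ os ι α π) ↔
      Nonempty (CountRoadWitnessT3bWT D C O rr d n hn g₀ os ι α π) :=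
  ⟨fun ⟨X⟩ => ⟨X.toWT⟩, fun ⟨X⟩ => ⟨CountRoadWitnessT3bWT.toWTV X⟩⟩

/-- … and for every `θᵥ ≥ 0` the weighted shape at `O` is inhabited as soon as the `κ := costT` shape at `O` is
(`ofWTV`, p266167), while a weighted witness at `O` always gives a `κ := costT` witness at `reslack O θᵥ` (`toWTV`,
p265435). [folklore] -/
theorem nonempty_countRoadWitnessT3bWTVS_of {D : FiniteEpsData F G} {C : T4PrintedShapeBanking.Consts} {O : PrintedO1s}
    {θv : ℝ} (hθv : 0 ≤ θv) {rr d n : ℕ} {hn : 0 < n} {g₀ : ℕ → ℝ} {os : List (ULoop F)} {ι α π : Type}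
    [DecidableEq ι] [DecidableEq α] [DecidableEq π] (h : Nonempty (CountRoadWitnessT3bWT D C O rr d n hn g₀ os ι α π)) :
    Nonempty (CountRoadWitnessT3bWTVS D C O θv rr d n hn g₀ os ι α π) ∧
      Nonempty (CountRoadWitnessT3bWTV D C (reslack O θv) rr d n hn g₀ os ι α π) := by
  obtain ⟨X⟩ := h
  exact ⟨⟨ofWTV hθv (CountRoadWitnessT3bWT.toWTV X)⟩, ⟨(ofWTV hθv (CountRoadWitnessT3bWT.toWTV X)).toWTV⟩⟩

end Equiv

/-! ## §3 The decided toy transported: both new `hData` shapes are inhabited on one datum -/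

section Toy

variable (F : T4Family) (G : Type) [GaugeGroup G] [MeasurableSpace G] [HaarData G] [RegularGaugeGroup G]

/-- **THE `κ := costT` WITNESS TERM** for a CONSTANT run `g₀ ≡ g` and a string `os` with trivial product observable, for
EVERY `C O rr d n` — leaf-09's `toyWitnessT3bOf` along `toWT ≫ toWTV`. [decided toy] -/
def toyWitnessT3bWTVOf (C : T4PrintedShapeBanking.Consts) (O : PrintedO1s) (rr d n : ℕ) (hn : 0 < n) {g : ℝ}
    {g₀ : ℕ → ℝ} (hg₀ : ∀ K, g₀ K = g) {os : List (ULoop F)}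
    (hobs : ∀ (K : ℕ) (U : GaugeField (F.P K) 0 G), T4GenFunBounds.prodObs ((toyData F G).scheme g₀) K os U = 1) :
    CountRoadWitnessT3bWTV (toyData F G) C O rr d n hn g₀ os Unit Empty Unit :=
  CountRoadWitnessT3bWT.toWTV (CountRoadWitnessT3b.toWT (toyWitnessT3bOf F G C O rr d n hn hg₀ hobs))

/-- **THE WEIGHTED WITNESS TERM** (`θᵥ ≥ 0`, zero weight family) — the same along `ofWTV`. [decided toy] -/
def toyWitnessT3bWTVSOf (C : T4PrintedShapeBanking.Consts) (O : PrintedO1s) {θv : ℝ} (hθv : 0 ≤ θv) (rr d n : ℕ)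
    (hn : 0 < n) {g : ℝ} {g₀ : ℕ → ℝ} (hg₀ : ∀ K, g₀ K = g) {os : List (ULoop F)}
    (hobs : ∀ (K : ℕ) (U : GaugeField (F.P K) 0 G), T4GenFunBounds.prodObs ((toyData F G).scheme g₀) K os U = 1) :
    CountRoadWitnessT3bWTVS (toyData F G) C O θv rr d n hn g₀ os Unit Empty Unit :=
  ofWTV hθv (toyWitnessT3bWTVOf F G C O rr d n hn hg₀ hobs)

/-- the transported toy keeps leaf-09's data: one term per cutoff (`toyT`), weights `ZtoyOf`, no live component
[decided toy] -/
theorem toyWitnessT3bWTVOf_data (C : T4PrintedShapeBanking.Consts) (O : PrintedO1s) (rr d n : ℕ) (hn : 0 < n) {g : ℝ}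
    {g₀ : ℕ → ℝ} (hg₀ : ∀ K, g₀ K = g) {os : List (ULoop F)}
    (hobs : ∀ (K : ℕ) (U : GaugeField (F.P K) 0 G), T4GenFunBounds.prodObs ((toyData F G).scheme g₀) K os U = 1) :
    (toyWitnessT3bWTVOf F G C O rr d n hn hg₀ hobs).T = (toyWitnessT3bOf F G C O rr d n hn hg₀ hobs).T ∧
      (toyWitnessT3bWTVOf F G C O rr d n hn hg₀ hobs).A = (toyWitnessT3bOf F G C O rr d n hn hg₀ hobs).A ∧
      (toyWitnessT3bWTVOf F G C O rr d n hn hg₀ hobs).liveC = (toyWitnessT3bOf F G C O rr d n hn hg₀ hobs).liveC :=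
  ⟨rfl, rfl, rfl⟩

/-- **THE `κ := costT` SHAPE IS JOINTLY SATISFIABLE** (every `C O rr d n`; toy datum, empty string, `g₀ ≡ 1`).  A node test
of a hypothesis SHAPE; (B) fails at this datum; discharges nothing of the nine; NE7b NOT proved. [decided toy] -/
theorem nonempty_countRoadWitnessT3bWTV_toy (C : T4PrintedShapeBanking.Consts) (O : PrintedO1s) (rr d n : ℕ)
    (hn : 0 < n) :
    Nonempty (CountRoadWitnessT3bWTV (toyData F G) C O rr d n hn gOne ([] : List (ULoop F)) Unit Empty Unit) :=
  ⟨toyWitnessT3bWTVOf F G C O rr d n hn (g := 1) (fun _ => rfl) fun K U => prodObs_nil G ((toyData F G).scheme gOne) K U⟩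

/-- **THE WEIGHTED SHAPE IS JOINTLY SATISFIABLE** (every `C O rr d n`, every `θᵥ ≥ 0`; toy datum, empty string,
`g₀ ≡ 1`). [decided toy] -/
theorem nonempty_countRoadWitnessT3bWTVS_toy (C : T4PrintedShapeBanking.Consts) (O : PrintedO1s) {θv : ℝ}
    (hθv : 0 ≤ θv) (rr d n : ℕ) (hn : 0 < n) :
    Nonempty (CountRoadWitnessT3bWTVS (toyData F G) C O θv rr d n hn gOne ([] : List (ULoop F)) Unit Empty Unit) :=
  ⟨toyWitnessT3bWTVSOf F G C O hθv rr d n hn (g := 1) (fun _ => rfl) fun K U =>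
    prodObs_nil G ((toyData F G).scheme gOne) K U⟩

/-- **THE V-HEADLINE's DISPLAYED ANTECEDENT `hData` HOLDS ON THE TOY DATUM over a subsingleton regular gauge group**
(every loop variable is `1`): `ForSmallCouplings (toyData F G) (fun g₀ => ∀ os, ∃ ι α π …, Nonempty (CountRoadWitnessT3bWTV …))`
— the binder of `continuumYM4Torus_of_countRoadT3bWTV_fsc` ∕ `hybridNE7Under_of_countRoadT3bWTV_fsc` (p263890) VERBATIM on
one datum, thresholds `γ₀ = g₁ = 1`.  (B) fails there; discharges nothing; NE7b NOT proved. [decided toy] -/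
theorem forSmallCouplings_countRoadWitnessT3bWTV_toy [Subsingleton G] (C : T4PrintedShapeBanking.Consts)
    (O : PrintedO1s) (rr d n : ℕ) (hn : 0 < n) :
    ForSmallCouplings (toyData F G) fun g₀ => ∀ os : List (ULoop F),
      ∃ (ι α π : Type) (_ : DecidableEq ι) (_ : DecidableEq α) (_ : DecidableEq π),
        Nonempty (CountRoadWitnessT3bWTV (toyData F G) C O rr d n hn g₀ os ι α π) :=
  (forSmallCouplings_countRoadWitnessT3b_toy F G C O rr d n hn).mono fun g₀ hg os => by
    obtain ⟨ι, α, π, i₁, i₂, i₃, ⟨X⟩⟩ := hg os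
    exact ⟨ι, α, π, i₁, i₂, i₃, ⟨CountRoadWitnessT3bWT.toWTV (CountRoadWitnessT3b.toWT X)⟩⟩

/-- **THE WEIGHTED HEADLINE's DISPLAYED ANTECEDENT `hData` HOLDS ON THE TOY DATUM over a subsingleton regular gauge
group**, for every `θᵥ ≥ 0`: the binder of `continuumYM4Torus_of_countRoadT3bWTVS_fsc` ∕
`hybridNE7Under_of_countRoadT3bWTVS_fsc` (p266167) VERBATIM on one datum.  (B) fails there; discharges nothing; NE7b NOT
proved. [decided toy] -/
theorem forSmallCouplings_countRoadWitnessT3bWTVS_toy [Subsingleton G] (C : T4PrintedShapeBanking.Consts)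
    (O : PrintedO1s) {θv : ℝ} (hθv : 0 ≤ θv) (rr d n : ℕ) (hn : 0 < n) :
    ForSmallCouplings (toyData F G) fun g₀ => ∀ os : List (ULoop F),
      ∃ (ι α π : Type) (_ : DecidableEq ι) (_ : DecidableEq α) (_ : DecidableEq π),
        Nonempty (CountRoadWitnessT3bWTVS (toyData F G) C O θv rr d n hn g₀ os ι α π) :=
  (forSmallCouplings_countRoadWitnessT3bWTV_toy F G C O rr d n hn).mono fun g₀ hg os => by
    obtain ⟨ι, α, π, i₁, i₂, i₃, ⟨X⟩⟩ := hg os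
    exact ⟨ι, α, π, i₁, i₂, i₃, ⟨ofWTV hθv X⟩⟩

/-- **… IN PARTICULAR AT `SU(1)`** (V-shape), on every family `F`, for every `C O rr d n`. [decided toy] -/
theorem forSmallCouplings_countRoadWitnessT3bWTV_toySU1 (C : T4PrintedShapeBanking.Consts) (O : PrintedO1s)
    (rr d n : ℕ) (hn : 0 < n) :
    ForSmallCouplings (toyData F (Matrix.specialUnitaryGroup (Fin 1) ℂ)) fun g₀ => ∀ os : List (ULoop F),
      ∃ (ι α π : Type) (_ : DecidableEq ι) (_ : DecidableEq α) (_ : DecidableEq π),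
        Nonempty (CountRoadWitnessT3bWTV (toyData F (Matrix.specialUnitaryGroup (Fin 1) ℂ)) C O rr d n hn g₀ os ι α π) :=
  haveI := subsingleton_SU1
  forSmallCouplings_countRoadWitnessT3bWTV_toy F _ C O rr d n hn

/-- **… IN PARTICULAR AT `SU(1)`** (weighted shape, every `θᵥ ≥ 0`), on every family `F`, for every `C O rr d n`.
[decided toy] -/
theorem forSmallCouplings_countRoadWitnessT3bWTVS_toySU1 (C : T4PrintedShapeBanking.Consts) (O : PrintedO1s)
    {θv : ℝ} (hθv : 0 ≤ θv) (rr d n : ℕ) (hn : 0 < n) :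
    ForSmallCouplings (toyData F (Matrix.specialUnitaryGroup (Fin 1) ℂ)) fun g₀ => ∀ os : List (ULoop F),
      ∃ (ι α π : Type) (_ : DecidableEq ι) (_ : DecidableEq α) (_ : DecidableEq π),
        Nonempty (CountRoadWitnessT3bWTVS (toyData F (Matrix.specialUnitaryGroup (Fin 1) ℂ)) C O θv rr d n hn g₀ os
          ι α π) :=
  haveI := subsingleton_SU1
  forSmallCouplings_countRoadWitnessT3bWTVS_toy F _ C O hθv rr d n hn

end Toy

/-! ## §4 The located obstruction on the placeholder inhabitant: the (γ) floor -/

section Stub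

variable (F : T4Family) (G : Type) [GaugeGroup G] [MeasurableSpace G] [HaarData G] [RegularGaugeGroup G]

/-- **ON THE TREE'S OWN INHABITANT THE WEIGHTED SHAPE IS EMPTY**: for `T4FiniteEpsInhabited.stubData` (χ := 0) there is
NO witness, whatever the constants, `θᵥ`, string, run and index types — the (γ) floor field asks
`0 < c₀ ≤ smallFieldMass = 0` (`smallFieldMass_stubData`), exactly as for `CountRoadWitnessT3b` (S12i-opt). [decided toy] -/
theorem isEmpty_countRoadWitnessT3bWTVS_stubData (av : (K j : ℕ) → Averaging (F.P K) j G)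
    (hmeas : ∀ K j, Measurable (av K j).avg) (hac : ∀ K k, k < K → HaarAC (av K k).avg)
    (C : T4PrintedShapeBanking.Consts) (O : PrintedO1s) (θv : ℝ) (rr d n : ℕ) (hn : 0 < n) (g₀ : ℕ → ℝ)
    (os : List (ULoop F)) (ι α π : Type) [DecidableEq ι] [DecidableEq α] [DecidableEq π] :
    IsEmpty (CountRoadWitnessT3bWTVS (stubData F G av hmeas hac) C O θv rr d n hn g₀ os ι α π) :=
  ⟨fun X => by
    have h := X.floor X.K₀ le_rfl
    rw [smallFieldMass_stubData] at h
    exact absurd h (not_le.2 X.c₀_pos)⟩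

/-- the same for the `κ := costT` shape [decided toy] -/
theorem isEmpty_countRoadWitnessT3bWTV_stubData (av : (K j : ℕ) → Averaging (F.P K) j G)
    (hmeas : ∀ K j, Measurable (av K j).avg) (hac : ∀ K k, k < K → HaarAC (av K k).avg)
    (C : T4PrintedShapeBanking.Consts) (O : PrintedO1s) (rr d n : ℕ) (hn : 0 < n) (g₀ : ℕ → ℝ)
    (os : List (ULoop F)) (ι α π : Type) [DecidableEq ι] [DecidableEq α] [DecidableEq π] :
    IsEmpty (CountRoadWitnessT3bWTV (stubData F G av hmeas hac) C O rr d n hn g₀ os ι α π) :=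
  ⟨fun X => by
    have h := X.floor X.K₀ le_rfl
    rw [smallFieldMass_stubData] at h
    exact absurd h (not_le.2 X.c₀_pos)⟩

end Stub

end

end Summit.QuantumFields.BalabanUV.T4Continuum.HistoryRealiseCellsRunApexWitnessT3bWTVS
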